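import Mathlib.Analysis.Normed.Module.Dual
import Literature.Analysis.FluidPDE.HarmonicMeanValue
import HarnessLib

/-!
# Harmonic functions on the whole space that vanish at infinity are zero

Analysis/FluidPDE support file (theorems only) in the decomposition of the named fact
`Literature.Analysis.FluidPDE.leray_solution_ckn_decay` (Kang–Miura–Tsai 2021, Lemmas 3.3–3.4):
the Liouville-type step of the pressure decomposition of local Leray solutions
(Kang–Miura–Tsai, IMRN 2021 = arXiv:1812.10509, App. 1, end of the proof of Lemma 3.4, p. 19:
"`W_{ε,t}(x) = ∫₀ᵗ η_ε * u(s) ds` is a bounded harmonic vector field which vanishes at spatial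
infinity. Thus `W_{ε,t} ≡ 0`").

**Theorem** (`harmonic_eq_zero_of_tendsto_cocompact`). Let `E` be a nontrivial
finite-dimensional real inner product space and let `η : E → ℝ` be harmonic on all of `E`
(Mathlib `InnerProductSpace.HarmonicOnNhd η univ`) with `η(x) → 0` as `|x| → ∞`
(`Filter.cocompact`). Then `η = 0`. Vector-valued version:
`harmonic_eq_zero_of_tendsto_cocompact'` (compose with the dual and use Hahn–Banach).

*Proof* (maximum-principle-free, from the weighted mean value property of the tree,
`integral_radial_mul_harmonic`, Gilbarg–Trudinger Thm. 2.1). With the radial tent weight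
`w_ρ(x) = max(ρ - |x|, 0)` one has `η(x₀) ∫ w_ρ = ∫ w_ρ(x) η(x₀ + x) dx`. Given `ε > 0`, `|η| ≤ ε`
off a closed ball `B̄(0, L)` and `|η| ≤ M` on it, so
`|η(x₀)| ∫ w_ρ ≤ ε ∫ w_ρ + M ρ |B̄(-x₀, L)|`, while `∫ w_ρ ≥ (ρ/2) |B(0, ρ/2)| = (ρ/2)^{d+1} |B₁|`
(`d = dim E ≥ 1`); letting `ρ → ∞` gives `|η(x₀)| ≤ ε`.

## References

* D. Gilbarg, N. S. Trudinger, *Elliptic partial differential equations of second order* (2001),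
  Thm. 2.1 (mean value) and the Liouville theorem following Thm. 2.10. [GilbargTrudinger2001]
* K. Kang, H. Miura, T.-P. Tsai, IMRN 2021 = arXiv:1812.10509, App. 1, proof of Lemma 3.4,
  p. 19. [KangMiuraTsai2020]
-/

noncomputable section

open MeasureTheory Set Filter Metric Topology InnerProductSpace Function Bornology
open scoped RealInnerProductSpace

namespace Literature.Analysis.FluidPDE

variable {E : Type*} [NormedAddCommGroup E] [InnerProductSpace ℝ E] [FiniteDimensional ℝ E]
  [MeasurableSpace E] [BorelSpace E]

/-! ### The radial tent weight -/

omit [InnerProductSpace ℝ E] [FiniteDimensional ℝ E] [MeasurableSpace E] [BorelSpace E] in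
/-- The tent weight `w_ρ(x) = max(ρ - |x|, 0)` is continuous. [folklore] -/
theorem continuous_tentWeight (ρ : ℝ) : Continuous fun x : E => max (ρ - ‖x‖) 0 :=
  (continuous_const.sub continuous_norm).max continuous_const

omit [InnerProductSpace ℝ E] [FiniteDimensional ℝ E] [MeasurableSpace E] [BorelSpace E] in
/-- The tent weight is at most `ρ` (for `ρ ≥ 0`). [folklore] -/
theorem tentWeight_le {ρ : ℝ} (hρ : 0 ≤ ρ) (x : E) : max (ρ - ‖x‖) 0 ≤ ρ :=
  max_le (by linarith [norm_nonneg x]) hρ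

omit [InnerProductSpace ℝ E] [FiniteDimensional ℝ E] [MeasurableSpace E] [BorelSpace E] in
/-- The tent weight vanishes off the closed ball of radius `ρ`. [folklore] -/
theorem tentWeight_eq_zero {ρ : ℝ} {x : E} (hx : ρ ≤ ‖x‖) : max (ρ - ‖x‖) 0 = 0 :=
  max_eq_right (by linarith)

omit [InnerProductSpace ℝ E] [FiniteDimensional ℝ E] [MeasurableSpace E] [BorelSpace E] in
/-- The tent weight is radial. [folklore] -/
theorem tentWeight_radial (ρ : ℝ) {x y : E} (h : ‖x‖ = ‖y‖) :
    max (ρ - ‖x‖) 0 = max (ρ - ‖y‖) 0 := by rw [h]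

omit [MeasurableSpace E] [BorelSpace E] in
/-- The tent weight has compact support (inside the closed ball of radius `ρ`). [folklore] -/
theorem hasCompactSupport_tentWeight (ρ : ℝ) : HasCompactSupport fun x : E => max (ρ - ‖x‖) 0 := by
  refine HasCompactSupport.of_support_subset_isCompact (isCompact_closedBall (0 : E) ρ) ?_
  intro x hx
  rw [mem_closedBall, dist_zero_right]
  by_contra h
  exact hx (tentWeight_eq_zero (le_of_lt (not_le.1 h)))

omit [InnerProductSpace ℝ E] [FiniteDimensional ℝ E] [MeasurableSpace E] [BorelSpace E] in
/-- On the ball of radius `ρ/2` the tent weight is at least `ρ/2`. [folklore] -/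
theorem half_le_tentWeight {ρ : ℝ} {x : E} (hx : x ∈ ball (0 : E) (ρ / 2)) :
    ρ / 2 ≤ max (ρ - ‖x‖) 0 := by
  rw [mem_ball_zero_iff] at hx
  exact le_max_of_le_left (by linarith)

/-- **Lower bound for the mass of the tent weight**: `(ρ/2) |B(0, ρ/2)| ≤ ∫ w_ρ`. [folklore] -/
theorem mul_measureReal_ball_le_integral_tentWeight (ρ : ℝ) :
    ρ / 2 * (volume : Measure E).real (ball (0 : E) (ρ / 2)) ≤ ∫ x : E, max (ρ - ‖x‖) 0 := by
  have hint : Integrable (fun x : E => max (ρ - ‖x‖) 0) :=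
    (continuous_tentWeight ρ).integrable_of_hasCompactSupport (hasCompactSupport_tentWeight ρ)
  calc ρ / 2 * (volume : Measure E).real (ball (0 : E) (ρ / 2))
      = ∫ _ in ball (0 : E) (ρ / 2), ρ / 2 := by
        rw [setIntegral_const, smul_eq_mul, mul_comm]
    _ ≤ ∫ x in ball (0 : E) (ρ / 2), max (ρ - ‖x‖) 0 :=
        setIntegral_mono_on (integrableOn_const measure_ball_lt_top.ne) hint.integrableOn
          measurableSet_ball fun x hx => half_le_tentWeight hx
    _ ≤ ∫ x, max (ρ - ‖x‖) 0 :=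
        setIntegral_le_integral hint (Eventually.of_forall fun _ => le_max_right _ _)

/-! ### The vanishing theorem -/

/-- **Harmonic functions vanishing at infinity are zero** (scalar case). If `η : E → ℝ` is
harmonic on all of the nontrivial finite-dimensional inner product space `E` and `η → 0` along
`Filter.cocompact E`, then `η = 0`. Proof by the weighted mean value property with tent weights
of radius `ρ → ∞`; see the module docstring.
[cite: GilbargTrudinger2001, Thm 2.1 (mean value property) and the Liouville theorem after Thm 2.10] -/
theorem harmonic_eq_zero_of_tendsto_cocompact [Nontrivial E] {η : E → ℝ}
    (hη : HarmonicOnNhd η univ) (h0 : Tendsto η (cocompact E) (𝓝 0)) : η = 0 := by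
  have hηc : Continuous η := (contDiff_two_of_harmonicOnNhd_univ hη).continuous
  funext x₀
  simp only [Pi.zero_apply]
  -- it suffices to show `‖η x₀‖ ≤ ε` for every `ε > 0`
  refine norm_eq_zero.1 (le_antisymm (le_of_forall_pos_le_add fun ε hε => ?_) (norm_nonneg _))
  rw [zero_add]
  -- `‖η‖ ≤ ε` off a closed ball `B̄(0, L)`
  have hev : ∀ᶠ y in cocompact E, ‖η y‖ ≤ ε := by
    have := h0.eventually (Metric.closedBall_mem_nhds (0 : ℝ) hε)
    filter_upwards [this] with y hy
    rwa [dist_zero_right] at hy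
  rw [← Metric.cobounded_eq_cocompact] at hev
  obtain ⟨L, -, hL⟩ := (Metric.hasBasis_cobounded_compl_closedBall (0 : E)).eventually_iff.1 hev
  -- `‖η‖ ≤ M'` on `B̄(0, L)`
  obtain ⟨M, hM⟩ := (isCompact_closedBall (0 : E) L).exists_bound_of_continuousOn
    hηc.continuousOn
  set M' : ℝ := max M 0 with hM'
  have hM'0 : 0 ≤ M' := le_max_right _ _
  set S : Set E := closedBall (-x₀) L with hS
  have hSm : MeasurableSet S := measurableSet_closedBall
  have hSfin : volume S < ⊤ := measure_closedBall_lt_top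
  -- dimension and the unit ball
  set d : ℕ := Module.finrank ℝ E with hd
  have hdpos : 0 < d := Module.finrank_pos
  set V₁ : ℝ := (volume : Measure E).real (ball (0 : E) 1) with hV₁
  have hV₁pos : 0 < V₁ :=
    ENNReal.toReal_pos (measure_ball_pos volume (0 : E) one_pos).ne' measure_ball_lt_top.ne
  set VS : ℝ := (volume : Measure E).real S with hVS
  have hVS0 : 0 ≤ VS := measureReal_nonneg
  -- the key inequality at every radius `ρ > 0`
  have key : ∀ ρ : ℝ, 0 < ρ →
      ‖η x₀‖ ≤ ε + M' * VS * 2 ^ (d + 1) * V₁⁻¹ * (ρ ^ d)⁻¹ := by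
    intro ρ hρ
    set w : E → ℝ := fun x => max (ρ - ‖x‖) 0 with hw_def
    have hw : Continuous w := continuous_tentWeight ρ
    have hwc : HasCompactSupport w := hasCompactSupport_tentWeight ρ
    have hwi : Integrable w := hw.integrable_of_hasCompactSupport hwc
    have hw0 : ∀ x, 0 ≤ w x := fun _ => le_max_right _ _
    set I : ℝ := ∫ x, w x with hI_def
    -- mass from below
    have hball : (volume : Measure E).real (ball (0 : E) (ρ / 2)) = (ρ / 2) ^ d * V₁ := by
      rw [hV₁, Measure.real, Measure.real, Measure.addHaar_ball_of_pos _ _ (half_pos hρ),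
        ENNReal.toReal_mul, ENNReal.toReal_ofReal (pow_nonneg (half_pos hρ).le _)]
    have hI : (ρ / 2) ^ (d + 1) * V₁ ≤ I := by
      have h := mul_measureReal_ball_le_integral_tentWeight (E := E) ρ
      rw [hball] at h
      calc (ρ / 2) ^ (d + 1) * V₁ = ρ / 2 * ((ρ / 2) ^ d * V₁) := by ring
        _ ≤ I := h
    have hIpos : 0 < I := lt_of_lt_of_le (by positivity) hI
    -- the mean value property
    have hmvp : ∫ x, w x * η (x₀ + x) = I * η x₀ :=
      integral_radial_mul_harmonic hη hw hwc (fun x y h => tentWeight_radial ρ h) x₀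
    -- pointwise bound of the integrand
    have hpt : ∀ x : E, ‖w x * η (x₀ + x)‖ ≤ ε * w x + M' * S.indicator w x := by
      intro x
      rw [norm_mul, Real.norm_of_nonneg (hw0 x)]
      by_cases hx : x₀ + x ∈ closedBall (0 : E) L
      · have hxS : x ∈ S := by
          rw [hS, mem_closedBall, dist_eq_norm, sub_neg_eq_add, add_comm]
          rwa [mem_closedBall, dist_zero_right] at hx
        rw [indicator_of_mem hxS]
        have h1 : ‖η (x₀ + x)‖ ≤ M' := (hM _ hx).trans (le_max_left _ _)
        have h2 : 0 ≤ ε * w x := mul_nonneg hε.le (hw0 x)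
        nlinarith [hw0 x]
      · have h1 : ‖η (x₀ + x)‖ ≤ ε := hL hx
        have h2 : 0 ≤ M' * S.indicator w x :=
          mul_nonneg hM'0 (indicator_nonneg (fun y _ => hw0 y) _)
        nlinarith [hw0 x]
    -- integrate
    have hwS : Integrable (S.indicator w) := hwi.indicator hSm
    have hbound : ‖I * η x₀‖ ≤ ε * I + M' * (ρ * VS) := by
      rw [← hmvp]
      calc ‖∫ x, w x * η (x₀ + x)‖ ≤ ∫ x, ‖w x * η (x₀ + x)‖ := norm_integral_le_integral_norm _
        _ ≤ ∫ x, (ε * w x + M' * S.indicator w x) := by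
            refine integral_mono_of_nonneg (Eventually.of_forall fun x => norm_nonneg _)
              ((hwi.const_mul ε).add (hwS.const_mul M')) (Eventually.of_forall hpt)
        _ = ε * I + M' * ∫ x in S, w x := by
            rw [integral_add (hwi.const_mul ε) (hwS.const_mul M'), integral_const_mul,
              integral_const_mul, integral_indicator hSm]
        _ ≤ ε * I + M' * (ρ * VS) := by
            gcongr
            calc ∫ x in S, w x ≤ ∫ _ in S, ρ :=
                  setIntegral_mono_on hwi.integrableOn (integrableOn_const hSfin.ne) hSm
                    fun x _ => tentWeight_le hρ.le x
              _ = ρ * VS := by rw [setIntegral_const, smul_eq_mul, mul_comm]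
    -- divide by the mass
    have h1 : ‖η x₀‖ ≤ ε + M' * (ρ * VS) / I := by
      rw [norm_mul, Real.norm_of_nonneg hIpos.le] at hbound
      have h := div_le_div_of_nonneg_right hbound hIpos.le
      rwa [mul_div_cancel_left₀ _ hIpos.ne', add_div, mul_div_cancel_right₀ _ hIpos.ne'] at h
    have h2 : M' * (ρ * VS) / I ≤ M' * VS * 2 ^ (d + 1) * V₁⁻¹ * (ρ ^ d)⁻¹ := by
      calc M' * (ρ * VS) / I ≤ M' * (ρ * VS) / ((ρ / 2) ^ (d + 1) * V₁) :=
            div_le_div_of_nonneg_left (by positivity) (by positivity) hI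
        _ = M' * VS * 2 ^ (d + 1) * V₁⁻¹ * (ρ ^ d)⁻¹ := by
            rw [div_pow]
            field_simp
            ring
    linarith
  -- let `ρ → ∞`
  have hlim : Tendsto (fun ρ : ℝ => ε + M' * VS * 2 ^ (d + 1) * V₁⁻¹ * (ρ ^ d)⁻¹) atTop
      (𝓝 (ε + M' * VS * 2 ^ (d + 1) * V₁⁻¹ * 0)) :=
    tendsto_const_nhds.add (tendsto_const_nhds.mul
      (tendsto_inv_atTop_zero.comp (tendsto_pow_atTop hdpos.ne')))
  rw [mul_zero, add_zero] at hlim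
  exact ge_of_tendsto hlim ((eventually_gt_atTop 0).mono fun ρ hρ => key ρ hρ)

/-- **Harmonic vector fields vanishing at infinity are zero.** If `w : E → F` is harmonic on
all of the nontrivial finite-dimensional inner product space `E` with values in a real normed
space `F`, and `w → 0` along `Filter.cocompact E`, then `w = 0` (compose with continuous linear
functionals, which preserve harmonicity, and use Hahn–Banach).
[cite: GilbargTrudinger2001, Thm 2.1 and the Liouville theorem after Thm 2.10] -/
theorem harmonic_eq_zero_of_tendsto_cocompact' [Nontrivial E] {F : Type*} [NormedAddCommGroup F]
    [NormedSpace ℝ F] {w : E → F} (hw : HarmonicOnNhd w univ)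
    (h0 : Tendsto w (cocompact E) (𝓝 0)) : w = 0 := by
  funext x
  rw [Pi.zero_apply]
  refine SeparatingDual.eq_zero_of_forall_dual_eq_zero (R := ℝ) fun l => ?_
  have h1 : HarmonicOnNhd ((l : F →L[ℝ] ℝ) ∘ w) univ := hw.comp_CLM (l : F →L[ℝ] ℝ)
  have h2 : Tendsto ((l : F →L[ℝ] ℝ) ∘ w) (cocompact E) (𝓝 0) := by
    have := ((l : F →L[ℝ] ℝ).continuous.tendsto 0).comp h0
    rwa [map_zero] at this
  have h3 := congr_fun (harmonic_eq_zero_of_tendsto_cocompact h1 h2) x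
  simpa using h3

end Literature.Analysis.FluidPDE
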